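import Literature.AnabelianGeometry.SemiGraphs.TemperedDecompositionOfProfinite
import Literature.AnabelianGeometry.AbsoluteAnabelian.GaloisSectionsFacts
import HarnessLib

/-!
# [SemiAnbd] Theorem 6.5 (ii) for `Π^temp` from the TYPED [Mzk8] = [GalSect] Theorem 1.3 (ii), by name

Mochizuki, *Semi-graphs of anabelioids*, Publ. RIMS **42** (2006) [SemiAnbd], §6, Theorem 6.5 (ii)
(Commensurable Terminality), manuscript p. 71; printed proof p. 72: «Assertions (i), (ii), (iv) follow
formally from [Mzk8], Theorem 1.3, (i), (ii), (iv), respectively.» [cite: MochizukiSemiAnbd2006, Thm 6.5(ii) pp.71-72]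
[Mzk8] = S. Mochizuki, *Galois sections in absolute anabelian geometry*, Nagoya Math. J. **179** (2005),
Thm. 1.3 (ii) p. 6 — typed in the tree (layer L4, abc-iut-L4) over the interface
`AbsoluteAnabelian.FundamentalExtension` (`Π_{X_K} ↠ G_K`, `Δ_X = Ker`) as the FACT-LIST rows
`AbsoluteAnabelian.GalSect.Thm_1_3_ii_points` (for the decomposition groups of the closed points of `X_K`,
parameter structure `GalSect.PointData`) and `AbsoluteAnabelian.GalSect.Thm_1_3_ii_cusps` (for the cusps,
`FundamentalExtension.CuspidalData`). [cite: MochizukiGalSect2005, Thm 1.3 (ii) p.6]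

PROOF-ONLY companion (abc-iut cell, block F, seat abc-iut-f-174, FACT-LIST row F-1708
`TemperedOrigin.TemperedDecompositionGroupsHolds`; theorems only — no `def`, no `instance`, no new named
fact).  `TemperedDecompositionOfProfinite.lean` reduces each clause of Thm. 6.5 (i)(ii)(iv) for the tempered
group `Π^temp_{X_K}` of a datum `X : TemperedCurve p` to the same clause of [Mzk8] Thm. 1.3 stated as an
explicit binder on the profinite completion `Π_{X_K} = X.PiHat`.  For clause (ii) the [Mzk8] input EXISTS AS
A TYPED FACT; this file discharges the two (ii)-binders of that reduction FROM THOSE FACTS BY NAME, through an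
explicit tempered ↔ profinite DICTIONARY saying that the L4 datum `(E, P, C)` IS the profinite completion of
`X` with its decomposition groups:

* `j : X.PiHat →ₜ* E.arith` injective — `Π_{X_K}` of the §6 interface identified INTO the `Π_{X_K}` of the
  L4 interface (an isomorphism in the intended situation; injectivity is all the transfer uses);
* `haug : E.aug (j y) = 1 ↔ X.augHat y = 1` — the two augmentations have the same kernel `Δ_X`
  ([SemiAnbd] p. 69 / [GalSect] §1 p. 4: the same exact sequence `1 → Δ_X → Π_{X_K} → G_K → 1`);
* `κ`, `hκ` (cusps of `X̄_K` ↦ `C.Cusp`, `C.Dcusp (κ x) = j(ι(D_x))`) and `π`, `hπ` (non-cuspidal closed points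
  ↦ `P.Point`, `P.decomp (π x) = j(ι(D_x))`) — the decomposition groups of [GalSect] §1 p. 6 ARE the images
  of the tempered ones (p. 71).

Results: `TemperedCurve.commensurator_map_toHat_eq_of_galSect` ([Mzk8] Thm. 1.3 (ii) first sentence ⇒ the
binder `h13ii` of `decompCommensurablyTerminal_of_hat`), `commensurator_eq_map_toHat_of_galSect_cusps`
([Mzk8] Thm. 1.3 (ii) second sentence ⇒ the binder `h13ii'`), and the assembled
`decompCommensurablyTerminal_of_galSect` / `decompEqCommensuratorOfOpenInertia_of_galSect`:
**[SemiAnbd] Thm. 6.5 (ii) for `Π^temp_{X_K}` conditional, BY NAME, on the FACT-LIST rows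
`GalSect.Thm_1_3_ii_points` / `GalSect.Thm_1_3_ii_cusps` at the dictionary-identified L4 datum** — the exact
content of the printed word «formally».  Clauses (i) and (iv) of [Mzk8] Thm. 1.3 are not typed in L4
(`GaloisSectionsFacts.lean`, «Deliberately NOT here»), so for them the raw binders of
`TemperedDecompositionOfProfinite.lean` remain the interface.

HONEST FRAMING.  Group theory and point-set topology only; [Mzk8] Thm. 1.3 (ii) is CONSUMED (as a
hypothesis named by the tree's predicate), not proved; the dictionary is a hypothesis, not a construction
(no tempered or profinite fundamental group of a curve exists in the tree); nothing here concerns the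
disputed parts of inter-universal Teichmüller theory or takes a side on [IUTchIII] Cor. 3.12; typed ≠ proved.
-/

noncomputable section

namespace Literature.AnabelianGeometry.SemiGraphs

open scoped Pointwise
open _root_.Topology
open Subgroup.Commensurable (commensurator)
open Literature.AnabelianGeometry.AbsoluteAnabelian

universe u

/-! ### Generic: a commensurator identity is reflected along an injective homomorphism -/

/-- If `C_{G'}(f H) = f K` for an injective `f : G → G'`, then `C_G(H) = K` (commensurability is preserved
and reflected by `f`, `map_mem_commensurator_map_iff`; and `f g ∈ f K ⇔ g ∈ K`).
[cite: MochizukiGalSect2005, Thm 1.3 (ii) p.6] -/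
theorem commensurator_eq_of_commensurator_map_eq {G G' : Type*} [Group G] [Group G'] {f : G →* G'}
    (hf : Function.Injective f) {H K : Subgroup G} (h : commensurator (H.map f) = K.map f) :
    commensurator H = K := by
  ext g
  rw [← map_mem_commensurator_map_iff hf H g, h]
  exact Subgroup.mem_map_iff_mem hf

namespace TemperedCurve

variable {p : ℕ} [Fact p.Prime] (X : TemperedCurve p)

/-! ### The dictionary transports `Î_x = ι(D_x) ∩ Ker(augHat)` to `C.Icusp = C.Dcusp ∩ Δ_X` -/

/-- Under an injective `j : Π_{X_K} → E.arith` compatible with the augmentations (`E.aug (j y) = 1 ↔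
augHat y = 1`), the image of `Î_x = D̂_x ∩ Ker(augHat)` is `j(D̂_x) ∩ Δ_X` (`Δ_X = E.geom = Ker E.aug`).
[cite: MochizukiGalSect2005, §1 p.6] -/
theorem map_inf_ker_augHat_eq {E : FundamentalExtension.{u}} (j : X.PiHat →ₜ* E.arith)
    (hj : Function.Injective j) (haug : ∀ y : X.PiHat, E.aug (j y) = 1 ↔ X.augHat y = 1)
    (D : Subgroup X.PiHat) :
    (D ⊓ X.augHat.toMonoidHom.ker).map j.toMonoidHom = D.map j.toMonoidHom ⊓ E.geom := by
  have hj' : Function.Injective j.toMonoidHom := fun _ _ h => hj h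
  rw [Subgroup.map_inf_eq _ _ _ hj']
  ext z
  constructor
  · intro h
    obtain ⟨hzD, ⟨y, hy, rfl⟩⟩ := Subgroup.mem_inf.mp h
    refine Subgroup.mem_inf.mpr ⟨hzD, ?_⟩
    have hy' : X.augHat y = 1 := hy
    exact (FundamentalExtension.mem_geom E).mpr ((haug y).mpr hy')
  · intro h
    obtain ⟨⟨y, hyD, rfl⟩, hz⟩ := Subgroup.mem_inf.mp h
    have hz' : E.aug (j y) = 1 := (FundamentalExtension.mem_geom E).mp hz
    have hy : y ∈ X.augHat.toMonoidHom.ker := (haug y).mp hz'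
    exact Subgroup.mem_inf.mpr ⟨⟨y, hyD, rfl⟩, ⟨y, hy, rfl⟩⟩

/-! ### [Mzk8] Thm. 1.3 (ii), first sentence, BY NAME ⇒ the binder `h13ii` -/

/-- **[Mzk8] Thm. 1.3 (ii), first sentence, by name ⇒ `C_{Π_{X_K}}(D̂_x) = D̂_x` for every closed point.**
Given the dictionary (`j`, cusp index `κ` with `C.Dcusp (κ x) = j(D̂_x)`, point index `π` with
`P.decomp (π x) = j(D̂_x)`), the typed facts `GalSect.Thm_1_3_ii_points P` and (the first clause of)
`GalSect.Thm_1_3_ii_cusps C` give the commensurable terminality of every `j(D̂_x)` in `E.arith`, which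
reflects along the injective `j` to `D̂_x = ι(D_x)` in `Π_{X_K}` — the binder `h13ii` of
`decompCommensurablyTerminal_of_hat`. [cite: MochizukiSemiAnbd2006, Thm 6.5(ii) p.71] -/
theorem commensurator_map_toHat_eq_of_galSect {E : FundamentalExtension.{u}} (j : X.PiHat →ₜ* E.arith)
    (hj : Function.Injective j) (P : GalSect.PointData E) (C : E.CuspidalData)
    (κ : ∀ x : X.Pt, X.IsCusp x → C.Cusp)
    (hκ : ∀ (x : X.Pt) (hx : X.IsCusp x),
      C.Dcusp (κ x hx) = ((X.decomp x).map X.toHat.toMonoidHom).map j.toMonoidHom)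
    (π : ∀ x : X.Pt, ¬ X.IsCusp x → P.Point)
    (hπ : ∀ (x : X.Pt) (hx : ¬ X.IsCusp x),
      P.decomp (π x hx) = ((X.decomp x).map X.toHat.toMonoidHom).map j.toMonoidHom)
    (hP : GalSect.Thm_1_3_ii_points P) (hC : GalSect.Thm_1_3_ii_cusps C) (x : X.Pt) :
    commensurator ((X.decomp x).map X.toHat.toMonoidHom) = (X.decomp x).map X.toHat.toMonoidHom := by
  have hj' : Function.Injective j.toMonoidHom := fun _ _ h => hj h
  apply commensurator_eq_of_commensurator_map_eq hj'
  by_cases hx : X.IsCusp x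
  · have h := (hC.1 (κ x hx)).commensurator_eq
    rw [hκ x hx] at h
    exact h
  · have h := (hP (π x hx)).commensurator_eq
    rw [hπ x hx] at h
    exact h

/-! ### [Mzk8] Thm. 1.3 (ii), second sentence, BY NAME ⇒ the binder `h13ii'` -/

/-- **[Mzk8] Thm. 1.3 (ii), second sentence, by name ⇒ `C_{Π_{X_K}}(H) = D̂_x` for every closed
finite-index `H ⊆ Î_x` at a cusp.**  With the dictionary (`j` injective CONTINUOUS, augmentation
compatibility `haug`, cusp index `κ`, `hκ`): `j(H) ⊆ j(Î_x) = C.Dcusp ∩ Δ_X = C.Icusp` is closed (`H` is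
closed in the compact `Π_{X_K}`, `E.arith` is Hausdorff) of the same finite index (`j` injective), so the
second clause of the typed fact `GalSect.Thm_1_3_ii_cusps C` gives `C_{E.arith}(j H) = C.Dcusp = j(D̂_x)`,
which reflects along `j` — the binder `h13ii'` of `decompEqCommensuratorOfOpenInertia_of_hat`.
[cite: MochizukiSemiAnbd2006, Thm 6.5(ii) p.71] -/
theorem commensurator_eq_map_toHat_of_galSect_cusps {E : FundamentalExtension.{u}}
    (j : X.PiHat →ₜ* E.arith) (hj : Function.Injective j)
    (haug : ∀ y : X.PiHat, E.aug (j y) = 1 ↔ X.augHat y = 1) (C : E.CuspidalData)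
    (κ : ∀ x : X.Pt, X.IsCusp x → C.Cusp)
    (hκ : ∀ (x : X.Pt) (hx : X.IsCusp x),
      C.Dcusp (κ x hx) = ((X.decomp x).map X.toHat.toMonoidHom).map j.toMonoidHom)
    (hC : GalSect.Thm_1_3_ii_cusps C) (x : X.Pt) (hx : X.IsCusp x) (H : Subgroup X.PiHat)
    (hHI : H ≤ (X.decomp x).map X.toHat.toMonoidHom ⊓ X.augHat.toMonoidHom.ker)
    (hHc : IsClosed (H : Set X.PiHat))
    (hHf : (H.subgroupOf ((X.decomp x).map X.toHat.toMonoidHom ⊓ X.augHat.toMonoidHom.ker)).FiniteIndex) :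
    commensurator H = (X.decomp x).map X.toHat.toMonoidHom := by
  have hj' : Function.Injective j.toMonoidHom := fun _ _ h => hj h
  haveI : CompactSpace X.PiHat := X.isProfiniteCompletion_toHat.compactSpace
  -- the profinite inertia of the dictionary IS the image of `Î_x`
  have hI : C.Icusp (κ x hx) =
      ((X.decomp x).map X.toHat.toMonoidHom ⊓ X.augHat.toMonoidHom.ker).map j.toMonoidHom := by
    rw [C.Icusp_eq, hκ x hx, X.map_inf_ker_augHat_eq j hj haug]
  apply commensurator_eq_of_commensurator_map_eq hj'
  rw [← hκ x hx]
  apply hC.2 (κ x hx) (H.map j.toMonoidHom)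
  · rw [hI]
    exact Subgroup.map_mono hHI
  · rw [Subgroup.coe_map]
    exact ((hHc.isCompact).image j.continuous).isClosed
  · rw [hI]
    refine ⟨?_⟩
    change (H.map j.toMonoidHom).relIndex
        (((X.decomp x).map X.toHat.toMonoidHom ⊓ X.augHat.toMonoidHom.ker).map j.toMonoidHom) ≠ 0
    rw [Subgroup.relIndex_map_map_of_injective _ _ hj']
    exact Subgroup.FiniteIndex.index_ne_zero

/-! ### [SemiAnbd] Thm. 6.5 (ii) for `Π^temp` from the typed [Mzk8] Thm. 1.3 (ii), by name -/

/-- **[SemiAnbd] Thm. 6.5 (ii), first sentence** («`D_x` is commensurably terminal in `Π^temp_{X_K}`»; the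
typed node `X.DecompCommensurablyTerminal`) **conditional BY NAME on [Mzk8] Thm. 1.3 (ii)** — the FACT-LIST
rows `GalSect.Thm_1_3_ii_points P`, `GalSect.Thm_1_3_ii_cusps C` — at an L4 datum `(E, P, C)` identified with
the profinite completion of `X` by the dictionary (`j`, `κ`, `hκ`, `π`, `hπ`): «follows formally from [Mzk8],
Theorem 1.3 (ii)» (printed proof, p. 72). [cite: MochizukiSemiAnbd2006, Thm 6.5(ii) pp.71-72] -/
theorem decompCommensurablyTerminal_of_galSect {E : FundamentalExtension.{u}} (j : X.PiHat →ₜ* E.arith)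
    (hj : Function.Injective j) (P : GalSect.PointData E) (C : E.CuspidalData)
    (κ : ∀ x : X.Pt, X.IsCusp x → C.Cusp)
    (hκ : ∀ (x : X.Pt) (hx : X.IsCusp x),
      C.Dcusp (κ x hx) = ((X.decomp x).map X.toHat.toMonoidHom).map j.toMonoidHom)
    (π : ∀ x : X.Pt, ¬ X.IsCusp x → P.Point)
    (hπ : ∀ (x : X.Pt) (hx : ¬ X.IsCusp x),
      P.decomp (π x hx) = ((X.decomp x).map X.toHat.toMonoidHom).map j.toMonoidHom)
    (hP : GalSect.Thm_1_3_ii_points P) (hC : GalSect.Thm_1_3_ii_cusps C) :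
    X.DecompCommensurablyTerminal :=
  X.decompCommensurablyTerminal_of_hat (X.commensurator_map_toHat_eq_of_galSect j hj P C κ hκ π hπ hP hC)

/-- **[SemiAnbd] Thm. 6.5 (ii), second sentence** («if `x` is a cusp, then `D_x = C_{Π^temp_{X_K}}(H)` for
any open subgroup `H ⊆ I_x`»; the typed node `X.DecompEqCommensuratorOfOpenInertia`) **conditional BY NAME
on [Mzk8] Thm. 1.3 (ii) for cusps** — the FACT-LIST row `GalSect.Thm_1_3_ii_cusps C` — at an L4 datum
`(E, C)` identified with the profinite completion of `X` by the dictionary (`j` injective continuous, `haug`,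
`κ`, `hκ`). [cite: MochizukiSemiAnbd2006, Thm 6.5(ii) pp.71-72] -/
theorem decompEqCommensuratorOfOpenInertia_of_galSect {E : FundamentalExtension.{u}}
    (j : X.PiHat →ₜ* E.arith) (hj : Function.Injective j)
    (haug : ∀ y : X.PiHat, E.aug (j y) = 1 ↔ X.augHat y = 1) (C : E.CuspidalData)
    (κ : ∀ x : X.Pt, X.IsCusp x → C.Cusp)
    (hκ : ∀ (x : X.Pt) (hx : X.IsCusp x),
      C.Dcusp (κ x hx) = ((X.decomp x).map X.toHat.toMonoidHom).map j.toMonoidHom)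
    (hC : GalSect.Thm_1_3_ii_cusps C) :
    X.DecompEqCommensuratorOfOpenInertia :=
  X.decompEqCommensuratorOfOpenInertia_of_hat fun x hx H hHI hHc hHf =>
    X.commensurator_eq_map_toHat_of_galSect_cusps j hj haug C κ hκ hC x hx H hHI hHc hHf

/-- **[SemiAnbd] Thm. 6.5 (ii), both sentences, for `Π^temp_{X_K}`** from the typed [Mzk8] Thm. 1.3 (ii)
(`GalSect.Thm_1_3_ii_points`, `GalSect.Thm_1_3_ii_cusps`) BY NAME through the tempered ↔ profinite
dictionary. [cite: MochizukiSemiAnbd2006, Thm 6.5(ii) pp.71-72] -/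
theorem thm65ii_of_galSect {E : FundamentalExtension.{u}} (j : X.PiHat →ₜ* E.arith)
    (hj : Function.Injective j) (haug : ∀ y : X.PiHat, E.aug (j y) = 1 ↔ X.augHat y = 1)
    (P : GalSect.PointData E) (C : E.CuspidalData)
    (κ : ∀ x : X.Pt, X.IsCusp x → C.Cusp)
    (hκ : ∀ (x : X.Pt) (hx : X.IsCusp x),
      C.Dcusp (κ x hx) = ((X.decomp x).map X.toHat.toMonoidHom).map j.toMonoidHom)
    (π : ∀ x : X.Pt, ¬ X.IsCusp x → P.Point)
    (hπ : ∀ (x : X.Pt) (hx : ¬ X.IsCusp x),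
      P.decomp (π x hx) = ((X.decomp x).map X.toHat.toMonoidHom).map j.toMonoidHom)
    (hP : GalSect.Thm_1_3_ii_points P) (hC : GalSect.Thm_1_3_ii_cusps C) :
    X.DecompCommensurablyTerminal ∧ X.DecompEqCommensuratorOfOpenInertia :=
  ⟨X.decompCommensurablyTerminal_of_galSect j hj P C κ hκ π hπ hP hC,
    X.decompEqCommensuratorOfOpenInertia_of_galSect j hj haug C κ hκ hC⟩

end TemperedCurve

end Literature.AnabelianGeometry.SemiGraphs

end
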